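import Mathlib
import HarnessLib
import Summits.HubbardSuperconductivity.HubbardSuperconductivity.Theorems.KLProgrammeKLRegimeFlowReadScaleZeroSecondOrderWick
import Literature.MathematicalPhysics.QuantumLattice.HubbardUVSymbolCTDifferences
import Summits.HubbardSuperconductivity.HubbardSuperconductivity.Theorems.KLProgrammeKLRegimeSplitConsts

/-!
# Route `KLProgramme`, crux K3 — gen-8 ENGINE-FLOW child (stmt-HubbardSuperconductivity-20437 `KLRegimeEngineV17F2`), stub (C)
# `stub_twoLeg_curvature` at `n = 0`, located item #22 «(C)-SCALE0-PT2», step (π1b): THE OFF-DIAGONAL TWO-LEG KERNEL OF THE SCALE-`0`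
# GRID OUTPUT `W₀` THROUGH SECOND ORDER — SUNSET + HARTREE CHAIN + the Literature's order-`≥ 3` remainder, EXACTLY

Seat hubbard-kl-k3c5-p1 (g13; owner of #22).  With `V_N = Uε_N Σ_p w_p` the grid interaction and `C` a charge-conserving, spin-diagonal covariance
with point- and spin-independent tadpole `t` (every pulled-back normal covariance; at scale `0`: `S_{4M}ᵀ C⁰_{>e₀} S_{4M}`, `t₀ = −(βL²)⁻²Σ_kΨ⁰(k)`):

* §1 **`kernel_two_gaussConv_hubbardGridInteraction_mul_self`** — for grid points `p ≠ q`: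
  `kernel₂ (e^{Δ_C}(V_N·V_N)) ((p,σ,+),(q,σ,−)) = (Uε_N)²·∫dμ_C ∂_{ψ⁻_{qσ}}∂_{ψ⁺_{pσ}}(w_p w_q)` (the orderings `(p,q)`, `(q,p)` of the double sum give
  `½` each; any other pair of words is killed by one of the two external derivatives);
* §2 `gaussConv_hubbardGridInteraction_eq` (`e^{Δ_C}V_N = V_N + Uε_N t·Σψ⁺ψ⁻ + const`) and **`kernel_two_gaussConv_hubbardGridInteraction_sq_eq_zero`** —
  `(e^{Δ_C}V_N)²` has NO two-leg kernel at legs at different grid points (its quadratic monomials are on-site; everything else has degree ≠ 2);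
* §3 **`kernel_two_effAction_hubbardGridInteraction_offDiag`** — `kernel₂ (effAction C V_N) ((p,σ,+),(q,σ,−)) =
  −½(Uε_N)²·A(qσ⁺,pσ⁻)·(A(pσ̄⁺,qσ̄⁻)A(qσ̄⁺,pσ̄⁻) − t²) + kernel₂ R₃ (…)`, `R₃ = effAction C V − e^{Δ}V + ½(e^{Δ}(V²) − (e^{Δ}V)²)` — the element
  bounded by `Literature.….sum_wt_norm_kernel_effAction_sub_secondOrder_le_of_gramBounded`; the first-order (Hartree) kernel is grid-diagonal (p3's
  `kernel_two_gaussConv_hubbardGridInteraction_eq_zero_of_ne`);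
* §4 the scale-`0` instance **`kernel_two_scaleZero_effAction_offDiag`** (`C = S_{4M}ᵀC⁰_{>e₀}S_{4M}`, charge/spin rules from
  `gridSub_pullback_normalCovariance_apply_of_charge_eq/_of_spin_ne`, tadpole `contr_scaleZeroGridCov_samePoint`) — the EXACT decomposition the
  natural-size supplier of the door `…FlowReadScaleZeroDoors.twoLegRead_frameZero_of_offSite_certD` bounds term by term: SUNSET `−½(Uε)²A(q,p)A(p,q)A(q,p)`
  (off-site moments natural, k ≤ 2), HARTREE CHAIN `+½(Uε)²t₀²A(q,p)` (an `e(k⃗)`-function on the curve: subtracted before interpolation, alias-only),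
  remainder (order `≥ 3`, `×|U| ≤ 10⁻³⁷` by `…EngineV8DoorNumeralU9`).

Proofs only; no definitions; nothing here asserts any stub of 20437, K3 or superconductivity.  References: Salmhofer 1999 §2.3–2.4, §4.3 [cite: Salmhofer1999];
BGM 2006 §2.2 (2.12)–(2.14), (2.86)–(2.88) [cite: BenfattoGiulianiMastropietro2006].
-/

noncomputable section

namespace Summit.HubbardSuperconductivity.HubbardSuperconductivity.Theorems.KLRegimeSplit

set_option linter.dupNamespace false -- summit = problem name (single-conjunct summit), D-0017

open Literature.MathematicalPhysics.QuantumLattice Literature.Probability.LatticeModels GrassmannAlgebra Finset Matrix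
open Summit.HubbardSuperconductivity.HubbardSuperconductivity.Theorems.EngineV8

/-! ## §1–§3 The second cumulant and the full output, off the diagonal -/

section SecondCumulant

variable {L N : ℕ} [NeZero L] (C : Matrix (GridLeg (GridPoint L N)) (GridLeg (GridPoint L N)) ℂ)

omit [NeZero L] in
/-- The door's leg string `((p,σ),+), ((q,σ),−)` as a `![…]`. -/
theorem twoLegString_eq (p q : GridPoint L N) (σ : Fin 2) :
    (fun i : Fin 2 => (((![p, q] i, σ), i) : GridLeg (GridPoint L N))) = ![(((p, σ), 0) : GridLeg (GridPoint L N)), ((q, σ), 1)] := by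
  funext i; fin_cases i <;> rfl

/-- **The Gaussian expectation of the derived two-word monomial `w_{p'} w_{q'}` at the legs `((p,σ),+),((q,σ),−)` (`p ≠ q`)** is the paired
expectation of `w_p w_q` when `{p', q'} = {p, q}` and vanishes otherwise. -/
theorem gaussExpect_iterDeriv_two_gridWord_mul_gridWord_eq_ite (p q : GridPoint L N) (hpq : p ≠ q) (σ : Fin 2) (G : ℂ)
    (hG : gaussExpect ℂ C (iterDeriv ℂ ![(((p, σ), 0) : GridLeg (GridPoint L N)), ((q, σ), 1)] (gridWord L N p * gridWord L N q)) = G)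
    (p' q' : GridPoint L N) :
    gaussExpect ℂ C (iterDeriv ℂ ![(((p, σ), 0) : GridLeg (GridPoint L N)), ((q, σ), 1)] (gridWord L N p' * gridWord L N q')) =
      (if p' = p then (if q' = q then G else 0) else 0) + (if p' = q then (if q' = p then G else 0) else 0) := by
  by_cases h1 : p = p'
  · subst h1
    rw [if_pos (show p = p from rfl), if_neg (show ¬p = q from hpq), add_zero]
    by_cases h2 : q = q'
    · subst h2; rw [if_pos (show q = q from rfl), hG]
    · rw [if_neg (show ¬q' = q from fun h => h2 h.symm),
        iterDeriv_two_gridWord_mul_gridWord_eq_zero_right p q' p q hpq.symm h2 σ, map_zero]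
  · rw [if_neg (show ¬p' = p from fun h => h1 h.symm), zero_add]
    by_cases h3 : q = p'
    · subst h3
      rw [if_pos (show q = q from rfl)]
      by_cases h4 : p = q'
      · subst h4; rw [if_pos (show p = p from rfl), gridWord_mul_comm, hG]
      · rw [if_neg (show ¬q' = p from fun h => h4 h.symm),
          iterDeriv_two_gridWord_mul_gridWord_eq_zero_left q q' p q h1 h4 σ, map_zero]
    · rw [if_neg (show ¬p' = q from fun h => h3 h.symm)]
      by_cases h5 : p = q'
      · subst h5
        rw [iterDeriv_two_gridWord_mul_gridWord_eq_zero_right p' p p q h3 hpq.symm σ, map_zero]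
      · rw [iterDeriv_two_gridWord_mul_gridWord_eq_zero_left p' q' p q h1 h5 σ, map_zero]

/-- **THE TWO-LEG KERNEL OF `e^{Δ_C}(V_N²)` OFF THE DIAGONAL**: for `p ≠ q`,
`kernel₂ (e^{Δ_C}(V_N·V_N)) ((p,σ,+),(q,σ,−)) = (Uε_N)² · ∫dμ_C ∂_{ψ⁻_{qσ}}∂_{ψ⁺_{pσ}}(w_p w_q)` (the two orderings `(p,q)`, `(q,p)` of the double
sum each give `½`, every other pair of words is killed by one of the two external derivatives). -/
theorem kernel_two_gaussConv_hubbardGridInteraction_mul_self (β U : ℝ) (p q : GridPoint L N) (hpq : p ≠ q) (σ : Fin 2) :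
    kernel ℂ (gaussConv ℂ C (hubbardGridInteraction L N β U * hubbardGridInteraction L N β U)) 2 (fun i => ((![p, q] i, σ), i)) =
      ((U * (β / N) : ℝ) : ℂ) ^ 2 *
        gaussExpect ℂ C (iterDeriv ℂ ![(((p, σ), 0) : GridLeg (GridPoint L N)), ((q, σ), 1)] (gridWord L N p * gridWord L N q)) := by
  classical
  rw [twoLegString_eq]
  obtain ⟨G, hG⟩ : ∃ G : ℂ, gaussExpect ℂ C
      (iterDeriv ℂ ![(((p, σ), 0) : GridLeg (GridPoint L N)), ((q, σ), 1)] (gridWord L N p * gridWord L N q)) = G := ⟨_, rfl⟩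
  have hVV : hubbardGridInteraction L N β U * hubbardGridInteraction L N β U =
      (((U * (β / N) : ℝ) : ℂ) * ((U * (β / N) : ℝ) : ℂ)) •
        ∑ p' : GridPoint L N, ∑ q' : GridPoint L N, gridWord L N p' * gridWord L N q' := by
    rw [hubbardGridInteraction, Algebra.smul_mul_assoc, Algebra.mul_smul_comm, smul_smul, Finset.sum_mul_sum]
  rw [hVV, map_smul, kernel_smul, map_sum, kernel_sum, hG]
  have hsum : ∑ p' : GridPoint L N, kernel ℂ (gaussConv ℂ C (∑ q' : GridPoint L N, gridWord L N p' * gridWord L N q')) 2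
        ![(((p, σ), 0) : GridLeg (GridPoint L N)), ((q, σ), 1)] =
      ∑ p' : GridPoint L N, ∑ q' : GridPoint L N, ((Nat.factorial 2 : ℚ)⁻¹ • (1 : ℂ)) *
        ((if p' = p then (if q' = q then G else 0) else 0) + (if p' = q then (if q' = p then G else 0) else 0)) := by
    refine Finset.sum_congr rfl fun p' _ => ?_
    rw [map_sum, kernel_sum]
    refine Finset.sum_congr rfl fun q' _ => ?_
    rw [kernel_gaussConv_eq_gaussExpect_iterDeriv, gaussExpect_iterDeriv_two_gridWord_mul_gridWord_eq_ite C p q hpq σ G hG p' q']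
  have h2 : ((Nat.factorial 2 : ℚ)⁻¹ • (1 : ℂ)) = (2 : ℂ)⁻¹ := by
    rw [Rat.smul_one_eq_cast]; push_cast [Nat.factorial]; norm_num
  have hA : ∑ p' : GridPoint L N, ∑ q' : GridPoint L N, (if p' = p then (if q' = q then G else 0) else 0) = G := by
    rw [Finset.sum_comm]; simp only [Finset.sum_ite_eq', Finset.mem_univ, if_true]
  have hB : ∑ p' : GridPoint L N, ∑ q' : GridPoint L N, (if p' = q then (if q' = p then G else 0) else 0) = G := by
    rw [Finset.sum_comm]; simp only [Finset.sum_ite_eq', Finset.mem_univ, if_true]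
  rw [hsum, h2]
  simp only [mul_add, Finset.sum_add_distrib, ← Finset.mul_sum, hA, hB]
  ring

omit [NeZero L] in
/-- `ψ(a)ψ(b)` as a `genProd`. -/
theorem gen_mul_gen_eq_genProd_two (a b : GridLeg (GridPoint L N)) :
    gen ℂ a * gen ℂ b = genProd ℂ ![a, b] := by
  rw [genProd_succ, genProd_succ, genProd_zero, mul_one]; rfl

omit [NeZero L] in
/-- `w_{p'} · ψ(Y₀)⋯ψ(Y_{m−1})` has no two-leg kernel (a monomial of degree `4 + m`). -/
theorem kernel_two_gridWord_mul_genProd {m : ℕ} (p' : GridPoint L N) (Y : Fin m → GridLeg (GridPoint L N)) (X : Fin 2 → GridLeg (GridPoint L N)) :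
    kernel ℂ (gridWord L N p' * genProd ℂ Y) 2 X = 0 := by
  rw [gridWord_eq_genProd, ← genProd_append]
  exact kernel_genProd_of_ne ℂ X _ (by omega)

omit [NeZero L] in
/-- `ψ(Y₀)⋯ψ(Y_{m−1}) · w_{p'}` has no two-leg kernel. -/
theorem kernel_two_genProd_mul_gridWord {m : ℕ} (p' : GridPoint L N) (Y : Fin m → GridLeg (GridPoint L N)) (X : Fin 2 → GridLeg (GridPoint L N)) :
    kernel ℂ (genProd ℂ Y * gridWord L N p') 2 X = 0 := by
  rw [gridWord_eq_genProd, ← genProd_append]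
  exact kernel_genProd_of_ne ℂ X _ (by omega)

/-- `V_N · ψ(Y₀)⋯ψ(Y_{m−1})` and `ψ(Y)·V_N` have no two-leg kernel. -/
theorem kernel_two_hubbardGridInteraction_mul_genProd {m : ℕ} (β U : ℝ) (Y : Fin m → GridLeg (GridPoint L N))
    (X : Fin 2 → GridLeg (GridPoint L N)) :
    kernel ℂ (hubbardGridInteraction L N β U * genProd ℂ Y) 2 X = 0 ∧ kernel ℂ (genProd ℂ Y * hubbardGridInteraction L N β U) 2 X = 0 := by
  constructor
  · rw [hubbardGridInteraction, Algebra.smul_mul_assoc, kernel_smul, Finset.sum_mul, kernel_sum,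
      Finset.sum_eq_zero fun p' _ => kernel_two_gridWord_mul_genProd p' Y X, mul_zero]
  · rw [hubbardGridInteraction, Algebra.mul_smul_comm, kernel_smul, Finset.mul_sum, kernel_sum,
      Finset.sum_eq_zero fun p' _ => kernel_two_genProd_mul_gridWord p' Y X, mul_zero]

variable (hcharge : ∀ X Y : GridLeg (GridPoint L N), X.2 = Y.2 → contr ℂ C X Y = 0)
  (hspin : ∀ X Y : GridLeg (GridPoint L N), X.1.2 ≠ Y.1.2 → contr ℂ C X Y = 0)
  {t : ℂ} (ht : ∀ (q : GridPoint L N) (σ : Fin 2), contr ℂ C (((q, σ), 0) : GridLeg (GridPoint L N)) ((q, σ), 1) = t)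
include hcharge hspin ht

/-- **The Gaussian convolution of the grid interaction, explicitly** (translation/spin-invariant tadpole `t`):
`e^{Δ_C}V_N = V_N + (Uε_N t)·Σ_{q,σ}ψ⁺_{qσ}ψ⁻_{qσ} + (Uε_N·#points·t²)·1`. -/
theorem gaussConv_hubbardGridInteraction_eq [NeZero N] (β U : ℝ) :
    gaussConv ℂ C (hubbardGridInteraction L N β U) =
      hubbardGridInteraction L N β U +
        (((U * (β / N) : ℝ) : ℂ) * t) • (∑ q : GridPoint L N, ∑ σ : Fin 2,
          gen ℂ (((q, σ), 0) : GridLeg (GridPoint L N)) * gen ℂ (((q, σ), 1) : GridLeg (GridPoint L N))) +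
        (((U * (β / N) : ℝ) : ℂ) * (Fintype.card (GridPoint L N) : ℂ) * (t * t)) • (1 : GrassmannAlgebra ℂ (GridLeg (GridPoint L N))) := by
  have hword : ∀ q : GridPoint L N, gaussConv ℂ C (gridWord L N q) =
      gridWord L N q + t • (∑ σ : Fin 2, gen ℂ (((q, σ), 0) : GridLeg (GridPoint L N)) * gen ℂ (((q, σ), 1) : GridLeg (GridPoint L N))) +
        algebraMap ℂ _ (t * t) := by
    intro q
    rw [gaussConv_gridWord C hcharge hspin q, ht q 0, ht q 1, Fin.sum_univ_two, smul_add]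
  unfold hubbardGridInteraction
  rw [map_smul, map_sum]
  simp only [hword, sum_add_distrib, ← Finset.smul_sum, sum_const, card_univ, Algebra.algebraMap_eq_smul_one, smul_add,
    smul_smul, ← Nat.cast_smul_eq_nsmul ℂ]
  congr 2
  ring

omit hcharge hspin ht in
/-- The on-site density `Σ_{q,σ}ψ⁺_{qσ}ψ⁻_{qσ}`: no two-leg kernel off the diagonal, none for its square, none for its products with `V_N`. -/
theorem kernel_two_onSiteDensity_facts (β U : ℝ) (Y : Fin 2 → GridLeg (GridPoint L N)) (hY : (Y 0).1.1 ≠ (Y 1).1.1) :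
    kernel ℂ (∑ q : GridPoint L N, ∑ σ : Fin 2,
        gen ℂ (((q, σ), 0) : GridLeg (GridPoint L N)) * gen ℂ (((q, σ), 1) : GridLeg (GridPoint L N))) 2 Y = 0 ∧
    kernel ℂ ((∑ q : GridPoint L N, ∑ σ : Fin 2,
        gen ℂ (((q, σ), 0) : GridLeg (GridPoint L N)) * gen ℂ (((q, σ), 1) : GridLeg (GridPoint L N))) *
      (∑ q : GridPoint L N, ∑ σ : Fin 2,
        gen ℂ (((q, σ), 0) : GridLeg (GridPoint L N)) * gen ℂ (((q, σ), 1) : GridLeg (GridPoint L N)))) 2 Y = 0 ∧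
    kernel ℂ ((∑ q : GridPoint L N, ∑ σ : Fin 2,
        gen ℂ (((q, σ), 0) : GridLeg (GridPoint L N)) * gen ℂ (((q, σ), 1) : GridLeg (GridPoint L N))) *
      hubbardGridInteraction L N β U) 2 Y = 0 ∧
    kernel ℂ (hubbardGridInteraction L N β U * (∑ q : GridPoint L N, ∑ σ : Fin 2,
        gen ℂ (((q, σ), 0) : GridLeg (GridPoint L N)) * gen ℂ (((q, σ), 1) : GridLeg (GridPoint L N)))) 2 Y = 0 := by
  refine ⟨?_, ?_, ?_, ?_⟩
  · rw [kernel_sum]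
    refine Finset.sum_eq_zero fun q _ => ?_
    rw [kernel_sum]
    exact Finset.sum_eq_zero fun σ _ =>
      kernel_two_gen_mul_gen_eq_zero_of_point_ne (((q, σ), 0) : GridLeg (GridPoint L N)) ((q, σ), 1) rfl Y hY
  · rw [Finset.sum_mul_sum, kernel_sum]
    refine Finset.sum_eq_zero fun q _ => ?_
    rw [kernel_sum]
    refine Finset.sum_eq_zero fun q' _ => ?_
    rw [Finset.sum_mul_sum, kernel_sum]
    refine Finset.sum_eq_zero fun σ _ => ?_
    rw [kernel_sum]
    refine Finset.sum_eq_zero fun σ' _ => ?_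
    rw [gen_mul_gen_eq_genProd_two, gen_mul_gen_eq_genProd_two, ← genProd_append]
    exact kernel_genProd_of_ne ℂ Y _ (by omega)
  · rw [Finset.sum_mul, kernel_sum]
    refine Finset.sum_eq_zero fun q _ => ?_
    rw [Finset.sum_mul, kernel_sum]
    refine Finset.sum_eq_zero fun σ _ => ?_
    rw [gen_mul_gen_eq_genProd_two]
    exact (kernel_two_hubbardGridInteraction_mul_genProd β U _ Y).2
  · rw [Finset.mul_sum, kernel_sum]
    refine Finset.sum_eq_zero fun q _ => ?_
    rw [Finset.mul_sum, kernel_sum]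
    refine Finset.sum_eq_zero fun σ _ => ?_
    rw [gen_mul_gen_eq_genProd_two]
    exact (kernel_two_hubbardGridInteraction_mul_genProd β U _ Y).1

omit hcharge hspin ht in
/-- `V_N` and `V_N²` have no two-leg kernel; `1` has none. -/
theorem kernel_two_hubbardGridInteraction_facts (β U : ℝ) (Y : Fin 2 → GridLeg (GridPoint L N)) :
    kernel ℂ (hubbardGridInteraction L N β U) 2 Y = 0 ∧
      kernel ℂ (hubbardGridInteraction L N β U * hubbardGridInteraction L N β U) 2 Y = 0 ∧
        kernel ℂ (1 : GrassmannAlgebra ℂ (GridLeg (GridPoint L N))) 2 Y = 0 := by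
  refine ⟨?_, ?_, ?_⟩
  · rw [hubbardGridInteraction, kernel_smul, kernel_sum, Finset.sum_eq_zero fun p' _ => kernel_two_gridWord p' Y, mul_zero]
  · have hV : hubbardGridInteraction L N β U = ((U * (β / N) : ℝ) : ℂ) • ∑ q' : GridPoint L N, genProd ℂ (gridWordLegs L N q') := by
      simp only [hubbardGridInteraction, gridWord_eq_genProd]
    conv_lhs => rw [show hubbardGridInteraction L N β U * hubbardGridInteraction L N β U =
      hubbardGridInteraction L N β U * (((U * (β / N) : ℝ) : ℂ) • ∑ q' : GridPoint L N, genProd ℂ (gridWordLegs L N q')) by rw [← hV]]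
    rw [mul_smul_comm, kernel_smul, Finset.mul_sum, kernel_sum,
      Finset.sum_eq_zero fun q' _ => (kernel_two_hubbardGridInteraction_mul_genProd β U _ Y).1, mul_zero]
  · rw [show (1 : GrassmannAlgebra ℂ (GridLeg (GridPoint L N))) = algebraMap ℂ _ 1 from
      ((algebraMap ℂ (GrassmannAlgebra ℂ (GridLeg (GridPoint L N)))).map_one).symm]
    exact kernel_two_algebraMap 1 Y

/-- **`(e^{Δ_C}V_N)²` has no two-leg kernel off the diagonal**: its only quadratic monomials are the on-site `ψ⁺_{qσ}ψ⁻_{qσ}`. -/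
theorem kernel_two_gaussConv_hubbardGridInteraction_sq_eq_zero [NeZero N] (β U : ℝ) (Y : Fin 2 → GridLeg (GridPoint L N))
    (hY : (Y 0).1.1 ≠ (Y 1).1.1) :
    kernel ℂ (gaussConv ℂ C (hubbardGridInteraction L N β U) * gaussConv ℂ C (hubbardGridInteraction L N β U)) 2 Y = 0 := by
  obtain ⟨hS, hSS, hSV, hVS⟩ := kernel_two_onSiteDensity_facts (L := L) (N := N) β U Y hY
  obtain ⟨hV, hVV, h1⟩ := kernel_two_hubbardGridInteraction_facts (L := L) (N := N) β U Y
  rw [gaussConv_hubbardGridInteraction_eq C hcharge hspin ht β U]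
  simp only [add_mul, mul_add, smul_mul_assoc, mul_smul_comm, one_mul, mul_one, kernel_add, kernel_smul,
    hS, hSS, hSV, hVS, hV, hVV, h1, mul_zero, add_zero]

/-- **THE TWO-LEG KERNEL OF `W = effAction C V_N` OFF THE DIAGONAL = SECOND ORDER EXPLICIT + ORDER-≥3 REMAINDER**: for `p ≠ q` and every spin,
`kernel₂ W ((p,σ,+),(q,σ,−)) = −½(Uε_N)²·A(qσ⁺,pσ⁻)·(A(pσ̄⁺,qσ̄⁻)A(qσ̄⁺,pσ̄⁻) − t²) + kernel₂ R₃ (…)`, with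
`R₃ = W − e^{Δ_C}V_N + ½(e^{Δ_C}(V_N²) − (e^{Δ_C}V_N)²)` (the Literature remainder's element, `GrassmannWeightedEffectiveActionTruncationDB`) and
`A = contr C`: the first-order (Hartree) part is grid-diagonal (p3), the square of the dressed vertex is on-site, and the cross term is Wick's
determinant — SUNSET `−½(Uε)²A(q,p)A(p,q)A(q,p)` plus HARTREE CHAIN `+½(Uε)²t²A(q,p)`. -/
theorem kernel_two_effAction_hubbardGridInteraction_offDiag [NeZero N] (β U : ℝ) (p q : GridPoint L N) (hpq : p ≠ q) (σ : Fin 2) :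
    kernel ℂ (effAction ℂ C (hubbardGridInteraction L N β U)) 2 (fun i => ((![p, q] i, σ), i)) =
      -(2 : ℂ)⁻¹ * (((U * (β / N) : ℝ) : ℂ) ^ 2 *
        (contr ℂ C (((q, σ), 0) : GridLeg (GridPoint L N)) ((p, σ), 1) *
          (contr ℂ C (((p, σ.rev), 0) : GridLeg (GridPoint L N)) ((q, σ.rev), 1) *
              contr ℂ C (((q, σ.rev), 0) : GridLeg (GridPoint L N)) ((p, σ.rev), 1) - t * t))) +
      kernel ℂ (effAction ℂ C (hubbardGridInteraction L N β U) - gaussConv ℂ C (hubbardGridInteraction L N β U) +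
        (2 : ℂ)⁻¹ • (gaussConv ℂ C (hubbardGridInteraction L N β U * hubbardGridInteraction L N β U) -
          gaussConv ℂ C (hubbardGridInteraction L N β U) * gaussConv ℂ C (hubbardGridInteraction L N β U))) 2
        (fun i => ((![p, q] i, σ), i)) := by
  have hY : ((fun i : Fin 2 => (((![p, q] i, σ), i) : GridLeg (GridPoint L N))) 0).1.1 ≠
      ((fun i : Fin 2 => (((![p, q] i, σ), i) : GridLeg (GridPoint L N))) 1).1.1 := by simpa using hpq
  have h1 := kernel_two_gaussConv_hubbardGridInteraction_eq_zero_of_ne C β U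
    (fun i : Fin 2 => (((![p, q] i, σ), i) : GridLeg (GridPoint L N))) hY
  have h2 := kernel_two_gaussConv_hubbardGridInteraction_mul_self C β U p q hpq σ
  have h3 := kernel_two_gaussConv_hubbardGridInteraction_sq_eq_zero C hcharge hspin ht β U
    (fun i : Fin 2 => (((![p, q] i, σ), i) : GridLeg (GridPoint L N))) hY
  have hW := gaussExpect_iterDeriv_two_gridWord_mul_gridWord C hcharge hspin p q hpq σ
  rw [ht p σ.rev, ht q σ.rev] at hW
  rw [kernel_add, kernel_sub_apply, kernel_smul, kernel_sub_apply, h1, h2, h3, hW]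
  ring

end SecondCumulant

/-! ## §4 The scale-`0` instance: `W₀ = effAction (S_{4M}ᵀ C⁰_{>e₀} S_{4M}) V_{4M}` -/

section Model

variable {L M : ℕ} [NeZero L] [NeZero M]

omit [NeZero M] in
/-- The scale-`0` grid covariance pairs only opposite charges. -/
theorem contr_scaleZeroGridCov_of_charge_eq (β μ : ℝ) (X Y : GridLeg (GridPoint L (2 * (2 * M)))) (h : X.2 = Y.2) :
    contr ℂ ((hubbardGridSub L M β (2 * (2 * M))).transpose * hubbardCovAboveCT L M β μ 0 0 klE0 *
        hubbardGridSub L M β (2 * (2 * M))) X Y = 0 := by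
  rw [contr_apply, hubbardGridSub, hubbardCovAboveCT_zero_seed_eq_normalCovariance_uvSymbolCT,
    gridSub_pullback_normalCovariance_apply_of_charge_eq _ _ _ _ h, gridSub_pullback_normalCovariance_apply_of_charge_eq _ _ _ _ h.symm,
    sub_zero, mul_zero]

omit [NeZero M] in
/-- The scale-`0` grid covariance is spin-diagonal. -/
theorem contr_scaleZeroGridCov_of_spin_ne (β μ : ℝ) (X Y : GridLeg (GridPoint L (2 * (2 * M)))) (h : X.1.2 ≠ Y.1.2) :
    contr ℂ ((hubbardGridSub L M β (2 * (2 * M))).transpose * hubbardCovAboveCT L M β μ 0 0 klE0 *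
        hubbardGridSub L M β (2 * (2 * M))) X Y = 0 := by
  rw [contr_apply, hubbardGridSub, hubbardCovAboveCT_zero_seed_eq_normalCovariance_uvSymbolCT,
    gridSub_pullback_normalCovariance_apply_of_spin_ne _ _ _ _ h, gridSub_pullback_normalCovariance_apply_of_spin_ne _ _ _ _ h.symm,
    sub_zero, mul_zero]

omit [NeZero M] in
/-- **The scale-`0` Hartree tadpole** `t₀ = contr (SᵀC⁰S)((q,σ),+)((q,σ),−) = −(βL²)⁻² Σ_k Ψ⁰(k)` — the same at every grid point and for both spins
(the truncated Matsubara sum of the UV symbol; its real part is the `τ = 0` value of the UV propagator). -/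
theorem contr_scaleZeroGridCov_samePoint (β μ : ℝ) (q : GridPoint L (2 * (2 * M))) (σ : Fin 2) :
    contr ℂ ((hubbardGridSub L M β (2 * (2 * M))).transpose * hubbardCovAboveCT L M β μ 0 0 klE0 *
        hubbardGridSub L M β (2 * (2 * M))) (((q, σ), 0) : GridLeg (GridPoint L (2 * (2 * M)))) ((q, σ), 1) =
      -∑ k : FreqMomentum L M, ((1 / (β * (L : ℝ) ^ 2) : ℝ) : ℂ) ^ 2 * uvSymbolCT L M β μ 0 klE0 (k, 0) := by
  rw [hubbardGridSub, hubbardCovAboveCT_zero_seed_eq_normalCovariance_uvSymbolCT, contr_gridSub_pullback_samePoint]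
  rfl

/-- **THE OFF-DIAGONAL TWO-LEG KERNEL OF THE SCALE-`0` GRID OUTPUT `W₀` THROUGH SECOND ORDER** (located item #22 «(C)-SCALE0-PT2», step (π1)):
for grid points `p ≠ q` of the `4M`-grid and every spin `σ`, with `A = contr (S_{4M}ᵀC⁰_{>e₀}S_{4M})` (the pulled-back UV propagator) and
`t₀` the scale-`0` tadpole,
`kernel₂ W₀ ((p,σ,+),(q,σ,−)) = −½(Uβ/4M)²·A(qσ⁺,pσ⁻)·(A(pσ̄⁺,qσ̄⁻)A(qσ̄⁺,pσ̄⁻) − t₀²) + kernel₂ R₃ ((p,σ,+),(q,σ,−))`: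
SUNSET + HARTREE CHAIN + the order-`≥ 3` remainder `R₃ = W₀ − e^{Δ}V + ½(e^{Δ}(V²) − (e^{Δ}V)²)` of `GrassmannWeightedEffectiveActionTruncationDB`. -/
theorem kernel_two_scaleZero_effAction_offDiag (β U μ : ℝ) (p q : GridPoint L (2 * (2 * M))) (hpq : p ≠ q) (σ : Fin 2) :
    kernel ℂ (effAction ℂ ((hubbardGridSub L M β (2 * (2 * M))).transpose * hubbardCovAboveCT L M β μ 0 0 klE0 *
        hubbardGridSub L M β (2 * (2 * M))) (hubbardGridInteraction L (2 * (2 * M)) β U)) 2 (fun i => ((![p, q] i, σ), i)) =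
      -(2 : ℂ)⁻¹ * (((U * (β / (2 * (2 * M) : ℕ)) : ℝ) : ℂ) ^ 2 *
        (contr ℂ ((hubbardGridSub L M β (2 * (2 * M))).transpose * hubbardCovAboveCT L M β μ 0 0 klE0 *
            hubbardGridSub L M β (2 * (2 * M))) (((q, σ), 0) : GridLeg (GridPoint L (2 * (2 * M)))) ((p, σ), 1) *
          (contr ℂ ((hubbardGridSub L M β (2 * (2 * M))).transpose * hubbardCovAboveCT L M β μ 0 0 klE0 *
                hubbardGridSub L M β (2 * (2 * M))) (((p, σ.rev), 0) : GridLeg (GridPoint L (2 * (2 * M)))) ((q, σ.rev), 1) *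
              contr ℂ ((hubbardGridSub L M β (2 * (2 * M))).transpose * hubbardCovAboveCT L M β μ 0 0 klE0 *
                hubbardGridSub L M β (2 * (2 * M))) (((q, σ.rev), 0) : GridLeg (GridPoint L (2 * (2 * M)))) ((p, σ.rev), 1) -
            (-∑ k : FreqMomentum L M, ((1 / (β * (L : ℝ) ^ 2) : ℝ) : ℂ) ^ 2 * uvSymbolCT L M β μ 0 klE0 (k, 0)) *
            (-∑ k : FreqMomentum L M, ((1 / (β * (L : ℝ) ^ 2) : ℝ) : ℂ) ^ 2 * uvSymbolCT L M β μ 0 klE0 (k, 0))))) +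
      kernel ℂ (effAction ℂ ((hubbardGridSub L M β (2 * (2 * M))).transpose * hubbardCovAboveCT L M β μ 0 0 klE0 *
            hubbardGridSub L M β (2 * (2 * M))) (hubbardGridInteraction L (2 * (2 * M)) β U) -
          gaussConv ℂ ((hubbardGridSub L M β (2 * (2 * M))).transpose * hubbardCovAboveCT L M β μ 0 0 klE0 *
            hubbardGridSub L M β (2 * (2 * M))) (hubbardGridInteraction L (2 * (2 * M)) β U) +
        (2 : ℂ)⁻¹ • (gaussConv ℂ ((hubbardGridSub L M β (2 * (2 * M))).transpose * hubbardCovAboveCT L M β μ 0 0 klE0 *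
              hubbardGridSub L M β (2 * (2 * M))) (hubbardGridInteraction L (2 * (2 * M)) β U * hubbardGridInteraction L (2 * (2 * M)) β U) -
          gaussConv ℂ ((hubbardGridSub L M β (2 * (2 * M))).transpose * hubbardCovAboveCT L M β μ 0 0 klE0 *
              hubbardGridSub L M β (2 * (2 * M))) (hubbardGridInteraction L (2 * (2 * M)) β U) *
            gaussConv ℂ ((hubbardGridSub L M β (2 * (2 * M))).transpose * hubbardCovAboveCT L M β μ 0 0 klE0 *
              hubbardGridSub L M β (2 * (2 * M))) (hubbardGridInteraction L (2 * (2 * M)) β U))) 2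
        (fun i => ((![p, q] i, σ), i)) :=
  kernel_two_effAction_hubbardGridInteraction_offDiag _ (contr_scaleZeroGridCov_of_charge_eq β μ) (contr_scaleZeroGridCov_of_spin_ne β μ)
    (fun q' σ' => contr_scaleZeroGridCov_samePoint β μ q' σ') β U p q hpq σ

end Model

end Summit.HubbardSuperconductivity.HubbardSuperconductivity.Theorems.KLRegimeSplit

end
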